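import Summits.ValiantsHypothesis.ValiantsHypothesis.Theorems.SymPencilPerFourInnerRankNormalForm
import Summits.ValiantsHypothesis.ValiantsHypothesis.Theorems.SymPencilPerFourInnerRankScalarBlock

/-!
# Route `SymPencil` — inner rank of the `2 | 2` row split of `per_4`: reduction of every
# `≤ 11`-square joint family to a PURE family of a (possibly) corrected polynomial
# (`--supports` stmt-ValiantsHypothesis-5674 `SdcSuperquadratic`; (8,8) column of the size tables,
# isotropic-kernel route, memo `NOTE-p6g15-5674-IR12-reduction.md` §3/§11 — normal-form analysis)

**Theorem** (`pure_reduction`).  Let `Σ_r c_r t_r((a,b),(y₂,y₃))² = per (a; b; y₂; y₃)` over a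
field of characteristic zero with `|ι| ≤ 11` squares and non-zero weights.  Then (up to the
`y₂ ↔ y₃` mirror) the PURE part `t'_r((a,b),(y₂,y₃)) := t_r((0,b),(y₂,0)) + t_r((a,0),(0,y₃))`
satisfies, with the SAME weights,
`Σ_r c_r t'_r((a,b),(y₂,y₃))² = per (a; b; y₂; y₃) - 2 Σ_r c_r t_r((a,0),(y₂,0)) t_r((0,b),(0,y₃))`,
and the correction is the product of the two scalar blocks of `NormalForm.normalForm`
(`= 2⟨v₀,v₀'⟩ ψ(a,y₂) ψ'(b,y₃)`): it vanishes iff the family reduces to a pure PER-design (the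
setting of `PureSymm.false_of_allX_of_symmIso`, i.e. problem P1 of the memo), otherwise one is in
the "peeled" case R2.

Proof: `normalForm` + `ScalarBlock.scalar_block_dichotomy` (for `A₂` and, through the
`a ↔ b`, `y₂ ↔ y₃`-swapped design, for `B₃`): the scalar blocks are isotropic and orthogonal to
`B₂`, `A₃`, so in `‖A₂y₂ + B₂y₂ + A₃y₃ + B₃y₃‖²_c` only `‖B₂y₂ + A₃y₃‖²_c` and the cross term
`2⟨A₂y₂, B₃y₃⟩_c` survive.  Honest framing: this finishes the CONDITIONAL reduction of the cells
`(8,8,10)`, `(8,8,11)` to P1/R2; no cell closes; the window `27 ≤ sdc(per_4) ≤ 29`, the crux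
and `VP ≠ VNP` are untouched.  No definitions, no named facts. [folklore]
-/

noncomputable section

-- single-conjunct layout: Sub = Summit, duplicated namespace component intended
set_option linter.dupNamespace false

namespace Summit.ValiantsHypothesis.ValiantsHypothesis.Theorems.SymPencilPerFourInnerRankPureReduction

open Matrix Finset Module
open Summit.ValiantsHypothesis.ValiantsHypothesis.Theorems.SymPencilPerFourInnerRankTenPairs
open Summit.ValiantsHypothesis.ValiantsHypothesis.Theorems.SymPencilPerFourInnerRankNormalForm
open Summit.ValiantsHypothesis.ValiantsHypothesis.Theorems.SymPencilPerFourInnerRankScalarBlock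

variable {K : Type*} [Field K] {ι : Type*} [Fintype ι]

/-- The three vanishing facts of a scalar block, in both branches of `scalar_block_dichotomy`.
[folklore] -/
theorem scalar_block_facts [CharZero K] (c : ι → K)
    (t : ι → (((Fin 4 → K) × (Fin 4 → K)) →ₗ[K] ((Fin 4 → K) × (Fin 4 → K)) →ₗ[K] K))
    (hJ : ∀ a b y₂ y₃ : Fin 4 → K,
      ∑ r, c r * (t r (a, b) (y₂, y₃)) ^ 2 = (Matrix.of ![a, b, y₂, y₃]).permanent)
    (v₀ : ι → K) (hv₀ : ∀ (a x : Fin 4 → K), ∃ s : K, (fun r => t r (a, 0) (x, 0)) = s • v₀) :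
    (∀ (a x : Fin 4 → K), ∑ r, c r * (t r (a, 0) (x, 0)) ^ 2 = 0) ∧
    (∀ (a x a' y : Fin 4 → K), ∑ r, c r * t r (a, 0) (x, 0) * t r (a', 0) (0, y) = 0) ∧
    (∀ (a x b x' : Fin 4 → K), ∑ r, c r * t r (a, 0) (x, 0) * t r (0, b) (x', 0) = 0) := by
  rcases scalar_block_dichotomy c t hJ v₀ hv₀ with hz | ⟨hQ, hA₃, hB₂⟩
  · refine ⟨fun a x => ?_, fun a x a' y => ?_, fun a x b x' => ?_⟩ <;> simp [hz]
  have hsr : ∀ a x, ∃ s : K, ∀ r, t r (a, 0) (x, 0) = s * v₀ r := fun a x => by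
    obtain ⟨s, hs⟩ := hv₀ a x
    exact ⟨s, fun r => by have := congr_fun hs r; simpa using this⟩
  refine ⟨fun a x => ?_, fun a x a' y => ?_, fun a x b x' => ?_⟩
  · obtain ⟨s, hs⟩ := hsr a x
    simp_rw [hs]
    have : ∑ r, c r * (s * v₀ r) ^ 2 = s ^ 2 * ∑ r, c r * v₀ r ^ 2 := by
      rw [Finset.mul_sum]; exact Finset.sum_congr rfl fun r _ => by ring
    rw [this, hQ, mul_zero]
  · obtain ⟨s, hs⟩ := hsr a x
    simp_rw [hs]
    have : ∑ r, c r * (s * v₀ r) * t r (a', 0) (0, y) = s * ∑ r, c r * v₀ r * t r (a', 0) (0, y) := by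
      rw [Finset.mul_sum]; exact Finset.sum_congr rfl fun r _ => by ring
    rw [this, hA₃, mul_zero]
  · obtain ⟨s, hs⟩ := hsr a x
    simp_rw [hs]
    have : ∑ r, c r * (s * v₀ r) * t r (0, b) (x', 0) = s * ∑ r, c r * v₀ r * t r (0, b) (x', 0) := by
      rw [Finset.mul_sum]; exact Finset.sum_congr rfl fun r _ => by ring
    rw [this, hB₂, mul_zero]

/-- **Reduction to a pure family.**  See the module docstring. [folklore] -/
theorem pure_reduction [CharZero K] [DecidableEq ι] (hι : Fintype.card ι ≤ 11)
    (c : ι → K) (hc : ∀ r, c r ≠ 0)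
    (t : ι → (((Fin 4 → K) × (Fin 4 → K)) →ₗ[K] ((Fin 4 → K) × (Fin 4 → K)) →ₗ[K] K))
    (hJ : ∀ a b y₂ y₃ : Fin 4 → K,
      ∑ r, c r * (t r (a, b) (y₂, y₃)) ^ 2 = (Matrix.of ![a, b, y₂, y₃]).permanent) :
    (∀ a b y₂ y₃ : Fin 4 → K,
      ∑ r, c r * (t r (0, b) (y₂, 0) + t r (a, 0) (0, y₃)) ^ 2 =
        (Matrix.of ![a, b, y₂, y₃]).permanent
          - 2 * ∑ r, c r * t r (a, 0) (y₂, 0) * t r (0, b) (0, y₃)) ∨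
    (∀ a b y₂ y₃ : Fin 4 → K,
      ∑ r, c r * (t r (a, 0) (y₂, 0) + t r (0, b) (0, y₃)) ^ 2 =
        (Matrix.of ![a, b, y₂, y₃]).permanent
          - 2 * ∑ r, c r * t r (0, b) (y₂, 0) * t r (a, 0) (0, y₃)) := by
  -- the four-block expansion of `t_r((a,b),(y₂,y₃))`
  have hsplit : ∀ (a b y₂ y₃ : Fin 4 → K) r, t r (a, b) (y₂, y₃) =
      t r (a, 0) (y₂, 0) + t r (0, b) (y₂, 0) + t r (a, 0) (0, y₃) + t r (0, b) (0, y₃) := by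
    intro a b y₂ y₃ r
    have hu : ((a, b) : (Fin 4 → K) × (Fin 4 → K)) = (a, 0) + (0, b) := by simp
    have hy : ((y₂, y₃) : (Fin 4 → K) × (Fin 4 → K)) = (y₂, 0) + (0, y₃) := by simp
    rw [hu, hy]; simp only [map_add, LinearMap.add_apply]; ring
  -- the `a ↔ b`, `y₂ ↔ y₃`-swapped design (its `A₂`-block is `B₃`, etc.)
  set tS : ι → (((Fin 4 → K) × (Fin 4 → K)) →ₗ[K] ((Fin 4 → K) × (Fin 4 → K)) →ₗ[K] K) :=
    fun r => ((t r).compl₁₂ (LinearEquiv.prodComm K (Fin 4 → K) (Fin 4 → K)).toLinearMap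
      LinearMap.id).compl₂ (LinearEquiv.prodComm K (Fin 4 → K) (Fin 4 → K)).toLinearMap with htS
  have hJS : ∀ a b y₂ y₃ : Fin 4 → K,
      ∑ r, c r * (tS r (a, b) (y₂, y₃)) ^ 2 = (Matrix.of ![a, b, y₂, y₃]).permanent :=
    hJ_yswap c _ (hJ_swap c t hJ)
  have htSap : ∀ r (a b y₂ y₃ : Fin 4 → K), tS r (a, b) (y₂, y₃) = t r (b, a) (y₃, y₂) :=
    fun r a b y₂ y₃ => by simp [htS]
  -- the `y₂ ↔ y₃`-swapped design (for the mirrored normal form)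
  set tY : ι → (((Fin 4 → K) × (Fin 4 → K)) →ₗ[K] ((Fin 4 → K) × (Fin 4 → K)) →ₗ[K] K) :=
    fun r => (t r).compl₂ (LinearEquiv.prodComm K (Fin 4 → K) (Fin 4 → K)).toLinearMap with htY
  have hJY : ∀ a b y₂ y₃ : Fin 4 → K,
      ∑ r, c r * (tY r (a, b) (y₂, y₃)) ^ 2 = (Matrix.of ![a, b, y₂, y₃]).permanent :=
    hJ_yswap c t hJ
  have htYap : ∀ r (a b y₂ y₃ : Fin 4 → K), tY r (a, b) (y₂, y₃) = t r (a, b) (y₃, y₂) :=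
    fun r a b y₂ y₃ => by simp [htY]
  -- the `a ↔ b`-swapped design (mirror of `tS` for case 2)
  set tB : ι → (((Fin 4 → K) × (Fin 4 → K)) →ₗ[K] ((Fin 4 → K) × (Fin 4 → K)) →ₗ[K] K) :=
    fun r => (t r).compl₁₂ (LinearEquiv.prodComm K (Fin 4 → K) (Fin 4 → K)).toLinearMap
      LinearMap.id with htB
  have hJB : ∀ a b y₂ y₃ : Fin 4 → K,
      ∑ r, c r * (tB r (a, b) (y₂, y₃)) ^ 2 = (Matrix.of ![a, b, y₂, y₃]).permanent :=
    hJ_swap c t hJ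
  have htBap : ∀ r (a b y₂ y₃ : Fin 4 → K), tB r (a, b) (y₂, y₃) = t r (b, a) (y₂, y₃) :=
    fun r a b y₂ y₃ => by simp [htB]
  -- generic final computation
  have final : ∀ (α β γ δ : ι → K) (P : K),
      ∑ r, c r * (α r + β r + γ r + δ r) ^ 2 = P →
      ∑ r, c r * α r ^ 2 = 0 → ∑ r, c r * δ r ^ 2 = 0 →
      ∑ r, c r * α r * β r = 0 → ∑ r, c r * α r * γ r = 0 →
      ∑ r, c r * δ r * β r = 0 → ∑ r, c r * δ r * γ r = 0 →
      ∑ r, c r * (β r + γ r) ^ 2 = P - 2 * ∑ r, c r * α r * δ r := by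
    intro α β γ δ P hT h1 h2 h3 h4 h5 h6
    have e : ∀ r, c r * (β r + γ r) ^ 2 = c r * (α r + β r + γ r + δ r) ^ 2 -
        (c r * α r ^ 2 + c r * δ r ^ 2 + 2 * (c r * α r * β r) + 2 * (c r * α r * γ r) +
          2 * (c r * δ r * β r) + 2 * (c r * δ r * γ r) + 2 * (c r * α r * δ r)) := fun r => by
      ring
    rw [Finset.sum_congr rfl fun r _ => e r, Finset.sum_sub_distrib, hT]
    simp only [Finset.sum_add_distrib, ← Finset.mul_sum, h1, h2, h3, h4, h5, h6]
    ring
  rcases normalForm hι c hc t hJ with ⟨v₀, v₀', hv₀, hv₀'⟩ | ⟨w₀, w₀', hw₀, hw₀'⟩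
  · left
    obtain ⟨F1, F2, F3⟩ := scalar_block_facts c t hJ v₀ hv₀
    -- facts for `B₃` through `tS`
    obtain ⟨G1, G2, G3⟩ := scalar_block_facts c tS hJS v₀' (fun b x => by
      obtain ⟨s, hs⟩ := hv₀' b x
      exact ⟨s, by rw [← hs]; funext r; exact htSap r b 0 x 0⟩)
    simp only [htSap] at G1 G2 G3
    intro a b y₂ y₃
    have hT := hJ a b y₂ y₃
    simp_rw [hsplit a b y₂ y₃] at hT
    refine final (fun r => t r (a, 0) (y₂, 0)) (fun r => t r (0, b) (y₂, 0))
      (fun r => t r (a, 0) (0, y₃)) (fun r => t r (0, b) (0, y₃)) _ hT (F1 a y₂) (G1 b y₃)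
      (F3 a y₂ b y₂) (F2 a y₂ a y₃) ?_ ?_
    · have := G2 b y₃ b y₂
      simpa [mul_comm, mul_assoc, mul_left_comm] using this
    · have := G3 b y₃ a y₃
      simpa [mul_comm, mul_assoc, mul_left_comm] using this
  · right
    -- mirrored normal form: `A₃` scalar (`w₀`), `B₂` scalar (`w₀'`); work with `tY` and `tB`
    obtain ⟨F1, F2, F3⟩ := scalar_block_facts c tY hJY w₀ (fun a x => by
      obtain ⟨s, hs⟩ := hw₀ a x
      exact ⟨s, by rw [← hs]; funext r; exact htYap r a 0 x 0⟩)
    simp only [htYap] at F1 F2 F3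
    obtain ⟨G1, G2, G3⟩ := scalar_block_facts c tB hJB w₀' (fun b x => by
      obtain ⟨s, hs⟩ := hw₀' b x
      exact ⟨s, by rw [← hs]; funext r; exact htBap r b 0 x 0⟩)
    simp only [htBap] at G1 G2 G3
    intro a b y₂ y₃
    have hT := hJ a b y₂ y₃
    simp_rw [hsplit a b y₂ y₃] at hT
    have hT' : ∑ r, c r * (t r (0, b) (y₂, 0) + t r (a, 0) (y₂, 0) + t r (0, b) (0, y₃)
        + t r (a, 0) (0, y₃)) ^ 2 = (Matrix.of ![a, b, y₂, y₃]).permanent := by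
      rw [← hT]; exact Finset.sum_congr rfl fun r _ => by ring
    refine final (fun r => t r (0, b) (y₂, 0)) (fun r => t r (a, 0) (y₂, 0))
      (fun r => t r (0, b) (0, y₃)) (fun r => t r (a, 0) (0, y₃)) _ hT' (G1 b y₂) (F1 a y₃)
      ?_ ?_ ?_ ?_
    · have := G3 b y₂ a y₂
      simpa [mul_comm, mul_assoc, mul_left_comm] using this
    · have := G2 b y₂ b y₃
      simpa [mul_comm, mul_assoc, mul_left_comm] using this
    · have := F2 a y₃ a y₂
      simpa [mul_comm, mul_assoc, mul_left_comm] using this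
    · have := F3 a y₃ b y₃
      simpa [mul_comm, mul_assoc, mul_left_comm] using this

end Summit.ValiantsHypothesis.ValiantsHypothesis.Theorems.SymPencilPerFourInnerRankPureReduction

end
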